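import Summits.CriticalPhenomena.PercolationContinuityZ3.Theorems.PercNearOneGluingNoHeavyLowerTailSunflowerAntipodalMatching
import HarnessLib
import HarnessLib.Audit

/-!
# `NoHeavyLowerTail` (crux stmt-CriticalPhenomena-4575), abstract sunflower cubic: the Σ-FORM of `IX-gen` — the founded split sets `Σ(S)`
# raise injectively into the kernel–bottom pairs (unconditional half), and the RAISING-MATCHING conjecture

Support file (seat `prim-l12-p2` gen 16; `--supports stmt-CriticalPhenomena-4575`).  Nothing is asserted about the crux; no `sorry`; the one
`@[conjecture]` definition is an obligation (census-true, unproved), used only as an explicit hypothesis.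
Memo: run/shared/lean/prim/prim-l12/prim-l12-p2/FINDING-g16-SANDWICH-AND-LATTICE-FORMS.md (§2–§3).

THE Σ-FORM (memo §2).  For up-sets `U₁, U₂`, an up-set `S ⊆ U₁ ∩ U₂` and a cube `W` put `R := (U₁ ∪ U₂) ∖ S` and
  `Σ(S) := {x ⊆ W : x ∈ S, W ∖ x ∉ S, no set of R lies inside x}`   (`sigmaSet`; the "`S`-founded" in-sides of `S`).
The exact identity `IX(S;A,B) = AH(S∪A, S∪B) − 2·#{x ∈ S ∖ (A∪B) : W∖x ∉ S}` (memo §2; verified for all triples of up-sets on 4 points) turns the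
lane's two-copy conjecture `IXGen` (`…SunflowerHallGladkov`) into
  (Σ-form)   `#cross U₁ U₂ W + #Σ(S) ≤ #kerBot U₁ U₂ W`   for all up-sets `U₁, U₂, S ⊆ U₁ ∩ U₂`
(`cross` = `C₁`-sides of the cross antipodal pairs, `kerBot` = kernel sides of the kernel–bottom pairs, `…SunflowerAntipodalMatching`).
Both families on the left inject into `kerBot` ALONG `⊆` separately: `gladkovMatching` (`T ⊆ ρ T`) for `cross`, and — this file —
`sigmaRaising` (`x ⊆ ι x`) for `Σ(S)`, by the antipodal matching of the up-set `↑R` applied to the complements.  The conjecture is their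
COMPATIBILITY: `RaisingMatching` (this file; census memo §3: all `(U₁,U₂,S)` on 4 points, 1.4·10⁵ / 6·10⁵ cases on 5 / 6 points, 0 failures) asks
for ONE injection of `cross ⊔ Σ(S)` into `kerBot` with `x ⊆ ι x`; it implies the Σ-form and is equivalent to its localisation
`#(E ∩ cross) + #(E ∩ Σ(S)) ≤ #(E ∩ kerBot)` for every up-set `E` (Hall).  Decoupled versions (`Σ(S)` into the part of `kerBot` not above `C₁`)
are false (memo §3).
-/

namespace Summit.CriticalPhenomena.PercolationContinuityZ3.Theorems.SunflowerPartition

open Finset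

namespace HallGladkov

variable {α : Type*} [DecidableEq α]

/-- `Σ(S)` inside the cube `W`: sets `x ∈ S` with `W ∖ x ∉ S` that contain no set of `R = (U₁ ∪ U₂) ∖ S`. [this work] -/
def sigmaSet [Fintype α] (U₁ U₂ S : Finset (Finset α)) (W : Finset α) : Finset (Finset α) :=
  W.powerset.filter fun x => x ∈ S ∧ W \ x ∉ S ∧ ∀ y ∈ (U₁ ∪ U₂) \ S, ¬ y ⊆ x

/-- **Σ(S) raises injectively into the kernel–bottom pairs** (this work, unconditional): for up-sets `U₁, U₂`, an up-set `S ⊆ U₁ ∩ U₂` and a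
cube `W` there is an injection `ι` on `Σ(S)` with `ι x ∈ kerBot U₁ U₂ W`, `ι x ∈ S` and `x ⊆ ι x`.  If `W ∖ x ∉ U₁ ∪ U₂` take `ι x = x`;
otherwise `W ∖ x` is an in-side of the up-set `Y = ↑R` (its complement `x` contains no set of `R`), and `ι x := W ∖ φ (W ∖ x)` for the
antipodal matching `φ` of `Y` (`…SunflowerAntipodalMatching`). [this work] -/
theorem sigmaRaising [Fintype α] {U₁ U₂ S : Finset (Finset α)} (h₁ : IsUpperSet (U₁ : Set (Finset α)))
    (h₂ : IsUpperSet (U₂ : Set (Finset α))) (hS : IsUpperSet (S : Set (Finset α))) (hSK : S ⊆ U₁ ∩ U₂) (W : Finset α) :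
    ∃ ι : Finset α → Finset α, Set.InjOn ι (sigmaSet U₁ U₂ S W : Set (Finset α)) ∧
      ∀ x ∈ sigmaSet U₁ U₂ S W, ι x ∈ kerBot U₁ U₂ W ∧ ι x ∈ S ∧ x ⊆ ι x := by
  classical
  -- the up-set `Y = ↑R ∩ (U₁ ∪ U₂) = ↑R`
  set Y : Finset (Finset α) := (U₁ ∪ U₂).filter fun T => ∃ y ∈ (U₁ ∪ U₂) \ S, y ⊆ T with hYdef
  have hU : IsUpperSet ((U₁ ∪ U₂ : Finset (Finset α)) : Set (Finset α)) := by
    intro A B hAB hA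
    rw [Finset.mem_coe, mem_union] at hA ⊢
    exact hA.elim (fun h => Or.inl (h₁ hAB h)) (fun h => Or.inr (h₂ hAB h))
  have hY : IsUpperSet (Y : Set (Finset α)) := by
    intro A B hAB hA
    rw [Finset.mem_coe, hYdef, mem_filter] at hA ⊢
    obtain ⟨hAU, y, hy, hyA⟩ := hA
    exact ⟨hU hAB hAU, y, hy, subset_trans hyA hAB⟩
  obtain ⟨φ, hinj, hφ⟩ := antipodalMatching hY W
  -- membership facts for `x ∈ Σ(S)`
  have hxW : ∀ x ∈ sigmaSet U₁ U₂ S W, x ⊆ W := fun x hx => mem_powerset.1 (mem_filter.1 hx).1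
  have hxS : ∀ x ∈ sigmaSet U₁ U₂ S W, x ∈ S := fun x hx => (mem_filter.1 hx).2.1
  have hxnY : ∀ x ∈ sigmaSet U₁ U₂ S W, x ∉ Y := by
    intro x hx hxY
    rw [hYdef, mem_filter] at hxY
    obtain ⟨_, y, hy, hyx⟩ := hxY
    exact (mem_filter.1 hx).2.2.2 y hy hyx
  -- if `W ∖ x ∈ U₁ ∪ U₂` then `W ∖ x ∈ IN(Y)`
  have hin : ∀ x ∈ sigmaSet U₁ U₂ S W, W \ x ∈ U₁ ∪ U₂ → W \ x ∈ inV Y W := by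
    intro x hx hc
    unfold inV
    rw [mem_filter, mem_powerset, Finset.sdiff_sdiff_eq_self (hxW x hx)]
    refine ⟨sdiff_subset, ?_, hxnY x hx⟩
    rw [hYdef, mem_filter]
    exact ⟨hc, W \ x, mem_sdiff.2 ⟨hc, (mem_filter.1 hx).2.2.1⟩, subset_rfl⟩
  refine ⟨fun x => if W \ x ∈ U₁ ∪ U₂ then W \ φ (W \ x) else x, ?_, ?_⟩
  · -- injectivity
    intro x hx x' hx' hxx'
    have hxm : x ∈ sigmaSet U₁ U₂ S W := hx
    have hxm' : x' ∈ sigmaSet U₁ U₂ S W := hx'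
    by_cases hc : W \ x ∈ U₁ ∪ U₂ <;> by_cases hc' : W \ x' ∈ U₁ ∪ U₂
    · simp only [hc, hc', if_true] at hxx'
      have hφW : φ (W \ x) ⊆ W := subset_trans (hφ _ (hin x hxm hc)).2 sdiff_subset
      have hφW' : φ (W \ x') ⊆ W := subset_trans (hφ _ (hin x' hxm' hc')).2 sdiff_subset
      have e : φ (W \ x) = φ (W \ x') := by
        have := congrArg (fun A => W \ A) hxx'
        simpa only [Finset.sdiff_sdiff_eq_self hφW, Finset.sdiff_sdiff_eq_self hφW'] using this
      have e2 : W \ x = W \ x' := hinj (hin x hxm hc) (hin x' hxm' hc') e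
      have := congrArg (fun A => W \ A) e2
      simpa only [Finset.sdiff_sdiff_eq_self (hxW x hxm), Finset.sdiff_sdiff_eq_self (hxW x' hxm')] using this
    · -- image of x is above ↑R's matching: its complement lies in OUT(Y) so `W ∖ (W ∖ φ _) = φ _ ∉ Y` while `x'` has `W ∖ x' ∉ U₁ ∪ U₂`
      simp only [hc, hc', if_true, if_false] at hxx'
      exfalso
      have hO := (hφ _ (hin x hxm hc)).1
      unfold outV at hO
      have hWO : W \ φ (W \ x) ∈ Y := (mem_filter.1 hO).2.2
      rw [hxx'] at hWO
      exact hxnY x' hxm' hWO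
    · simp only [hc, hc', if_true, if_false] at hxx'
      exfalso
      have hO := (hφ _ (hin x' hxm' hc')).1
      unfold outV at hO
      have hWO : W \ φ (W \ x') ∈ Y := (mem_filter.1 hO).2.2
      rw [← hxx'] at hWO
      exact hxnY x hxm hWO
    · simp only [hc, hc', if_false] at hxx'
      exact hxx'
  · intro x hx
    by_cases hc : W \ x ∈ U₁ ∪ U₂
    · simp only [hc, if_true]
      obtain ⟨hO, hOS⟩ := hφ _ (hin x hx hc)
      unfold outV at hO
      obtain ⟨hOW, hOY, hWOY⟩ := mem_filter.1 hO
      have hOW' : φ (W \ x) ⊆ W := mem_powerset.1 hOW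
      -- `x ⊆ W ∖ φ (W ∖ x)`
      have hxR : x ⊆ W \ φ (W \ x) := by
        intro a ha
        rw [mem_sdiff]
        refine ⟨hxW x hx ha, fun haO => ?_⟩
        have := hOS haO
        rw [mem_sdiff] at this
        exact this.2 ha
      have hRS : W \ φ (W \ x) ∈ S := hS hxR (hxS x hx)
      -- `φ (W ∖ x) ∉ U₁ ∪ U₂`: not in `S` (below `W ∖ x ∉ S`) and not in `R` (it is not in `Y ⊇ R`)
      have hOnotS : φ (W \ x) ∉ S := fun h => (mem_filter.1 hx).2.2.1 (hS hOS h)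
      have hOnotU : φ (W \ x) ∉ U₁ ∪ U₂ := by
        intro hOU
        apply hOY
        rw [hYdef, mem_filter]
        exact ⟨hOU, φ (W \ x), mem_sdiff.2 ⟨hOU, hOnotS⟩, subset_rfl⟩
      have hK : W \ φ (W \ x) ∈ U₁ ∩ U₂ := hSK hRS
      refine ⟨?_, hRS, hxR⟩
      unfold kerBot
      rw [mem_filter, mem_powerset, Finset.sdiff_sdiff_eq_self hOW']
      rw [mem_union, not_or] at hOnotU
      exact ⟨sdiff_subset, (mem_inter.1 hK).1, (mem_inter.1 hK).2, hOnotU.1, hOnotU.2⟩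
    · simp only [hc, if_false]
      have hK : x ∈ U₁ ∩ U₂ := hSK (hxS x hx)
      rw [mem_union, not_or] at hc
      refine ⟨?_, hxS x hx, subset_rfl⟩
      unfold kerBot
      rw [mem_filter, mem_powerset]
      exact ⟨hxW x hx, (mem_inter.1 hK).1, (mem_inter.1 hK).2, hc.1, hc.2⟩

/-- **RAISING MATCHING** (this work; OPEN, census-clean, memo §3): for up-sets `U₁, U₂`, an up-set `S ⊆ U₁ ∩ U₂` and a cube `W` there is ONE
injection of `cross U₁ U₂ W ⊔ Σ(S)` into `kerBot U₁ U₂ W` with `x ⊆ ι x` (`gladkovMatching` and `sigmaRaising` give the two halves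
separately).  It implies the Σ-form of `IXGen`.  An obligation, never a fact: use as `(h : RaisingMatching)`. [status: open] -/
@[conjecture] def RaisingMatching : Prop :=
  ∀ (α : Type) [Fintype α] [DecidableEq α] (U₁ U₂ S : Finset (Finset α)) (W : Finset α),
    IsUpperSet (U₁ : Set (Finset α)) → IsUpperSet (U₂ : Set (Finset α)) → IsUpperSet (S : Set (Finset α)) → S ⊆ U₁ ∩ U₂ →
      ∃ ι : Finset α → Finset α, Set.InjOn ι ((cross U₁ U₂ W ∪ sigmaSet U₁ U₂ S W : Finset (Finset α)) : Set (Finset α)) ∧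
        ∀ x ∈ cross U₁ U₂ W ∪ sigmaSet U₁ U₂ S W, ι x ∈ kerBot U₁ U₂ W ∧ x ⊆ ι x

/-- The counting consequence of `RaisingMatching`: `#cross + #Σ(S) ≤ #kerBot` (the Σ-form of `IXGen`, memo §2). [this work] -/
theorem card_cross_add_card_sigmaSet_le (h : RaisingMatching) {α : Type} [Fintype α] [DecidableEq α]
    {U₁ U₂ S : Finset (Finset α)} (h₁ : IsUpperSet (U₁ : Set (Finset α))) (h₂ : IsUpperSet (U₂ : Set (Finset α)))
    (hS : IsUpperSet (S : Set (Finset α))) (hSK : S ⊆ U₁ ∩ U₂) (W : Finset α) :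
    (cross U₁ U₂ W).card + (sigmaSet U₁ U₂ S W).card ≤ (kerBot U₁ U₂ W).card := by
  obtain ⟨ι, hinj, hι⟩ := h α U₁ U₂ S W h₁ h₂ hS hSK
  have hdisj : Disjoint (cross U₁ U₂ W) (sigmaSet U₁ U₂ S W) := by
    rw [Finset.disjoint_left]
    intro x hxc hxs
    unfold cross at hxc
    have hx2 : x ∉ U₂ := (mem_filter.1 hxc).2.2.1
    exact hx2 (mem_inter.1 (hSK (mem_filter.1 hxs).2.1)).2
  rw [← card_union_of_disjoint hdisj]
  exact Finset.card_le_card_of_injOn ι (fun x hx => (hι x hx).1) hinj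

end HallGladkov

end Summit.CriticalPhenomena.PercolationContinuityZ3.Theorems.SunflowerPartition
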